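import Summits.QuantumFields.BalabanUV.T4Continuum.Spine.BackgroundResolventTower

/-!
# T⁴ programme, spine node NE2 (U1a), tier B row B4.b — THE SANDWICH LAW: `PerturbationLaws` for a difference of two
# BOUNDED sandwich families `B_k = Z_kᴴ N_k Z_k` through a fixed unit layer, from two-level laws of the factors

ROUND-2 swarm `t4-ne2-formalise-*`, leaf prover 05 (`b2b-balaban-t4-ne2-formalise-leaf-05`), row **B4.b** of the NE2 tier-B table
(`t4/SKELETON-NE2-P1.md` §2B; trigger `t4/T4-NE2-TRIGGER.json`, conditions c1–c6).  Row B4 is the `DRD*` summand of Bałaban's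
covariant operator [Balaban1985BackgroundPropagators] (3.26) p. 395 «Δ_a = Δ + DRD* + Q*aQ», with `R = R(U)` the orthogonal projection
(3.21) and, by (3.25) p. 394, «Rf = (I − G′Q′*(Q′G′²Q′*)⁻¹Q′G′)f», `G′ = (Δ′_a)⁻¹`, `Δ′_a = Δ_U + Q′*aQ′` (3.24).  READING used by this row
(journal `CLAIMS.log` 2026-08-20 leaf-05 NOTE → leaf-10): with `P(U) := 1 − R(U) = G′Q′*(Q′G′²Q′*)⁻¹Q′G′` the summand
`D_U P(U) D_U*` FACTORISES as

  `D_U P(U) D_U* = Zᴴ N Z`,  `Z := Q′(U)·G′(U)·D_U*` (fine 1-forms ⊗ 𝔤 → UNIT-lattice scalars ⊗ 𝔤),  `N := (Q′G′²Q′*)⁻¹`,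

a product of BOUNDED operators (`‖D_U G′(U)‖² ≤ ‖G′(U)‖` by positivity — companion file `GaugeTermResolventBounds`), so the B4
perturbation `D_UP(U)D_U* − (∂P∂*) ⊗ 1` is a DIFFERENCE OF TWO BOUNDED SANDWICH FAMILIES through the SAME unit layer.  This file is the
abstract law for that shape, over level-indexed index families exactly like `Spine/BackgroundResolventTower`:

 * §1 **`SandwichLaws D J Z N z n ζ ν`** — the typed two-level data of ONE sandwich family: sizes `‖Z_k‖ ≤ z`, `‖N_k‖ ≤ n`, the
   SANDWICHED consistency of the outer factor `‖(Z_{k+1}J_k − Z_k)D_k⁻¹‖ ≤ ζ k` (the free propagator on the right absorbs the covariant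
   divergence, as in `Support/FirstOrderAdjointModel`), and the plain consistency of the unit-layer factor `‖N_{k+1} − N_k‖ ≤ ν k`.
   A hypothesis shape on DATA; asserted by nobody; NOT IN PRINT.
 * §2 algebra: the three-term splittings `Z′ᴴN′Z′J − JZᴴNZ = Z′ᴴN′(Z′J − Z) + Z′ᴴ(N′ − N)Z + (Z′ᴴ − JZᴴ)NZ` and
   `Z₁ᴴN₁Z₁ − Z₀ᴴN₀Z₀ = (Z₁ − Z₀)ᴴN₁Z₁ + Z₀ᴴ(N₁ − N₀)Z₁ + Z₀ᴴN₀(Z₁ − Z₀)`; the LEFT outer defect through the free tower: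
   `‖D_{k+1}⁻¹(Z_{k+1}ᴴ − J_kZ_kᴴ)‖ ≤ ζ k + z(2e₁ k + e₀ k)` from the injected / complement defects of `FreeTowerLaws` and Hermitian free
   propagators (**`opNorm_inv_mul_outer_defect_le`**).
 * §3 **`sandwich_consistent_le`**: (H-cons) for one family, `‖D_{k+1}⁻¹(B_{k+1}J_k − J_kB_k)D_k⁻¹‖ ≤ Esand g z n e₀ e₁ ζ ν k :=
   g·z·n·(2ζ k + z(2e₁ k + e₀ k)) + g²z²·ν k` (`‖D_k⁻¹‖ ≤ g`); **`perturbationLaws_sandwich_sub`**: for TWO families with the same free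
   tower, `PerturbationLaws D (k ↦ Z¹ᴴN¹Z¹ − Z⁰ᴴN⁰Z⁰) J (g·(2·z·n·δZ + z·z·δN)) (k ↦ Esand … ζ¹ ν¹ k + Esand … ζ⁰ ν⁰ k)` where
   `‖Z¹_k − Z⁰_k‖ ≤ δZ`, `‖N¹_k − N⁰_k‖ ≤ δN` carry the SMALLNESS (size of the background) and the consistency constant needs none.
   `Esand` is geometric when `e₀, e₁, ζ, ν` are (`Esand_le_geometric`), ready for `Spine/NE2PerturbedLayer.towerLimitRate_perturbed_king`.

What this file does NOT do (next files of the row): the RESOLVENT BOUNDS producing `z, n, δZ, δN, ζ, ν` from the scalar covariant tower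
(`‖D_UG′‖² ≤ ‖G′‖`, Neumann for `N(U)` around the `U = 1` datum `n₁ = sup_k ‖(Q′G′_1²Q′*)⁻¹‖`, scalar injected/complement laws via
`BackgroundResolventLaw.perturbed_injected_law`) — file `GaugeTermResolventBounds`; and the INSTANCE on row B4.a's typed objects
(`covGradC`, `Q′(U)`, `Δ′_a(U)`), which consumes node NE3's consistency BY NAME (row B6) — file `GaugeTermPerturbationLaw`.

HONEST FRAMING (T4-DAG p. 1).  [folklore]-level bookkeeping over finite matrices in the `ℓ²`-operator norm, statements OURS; model level
(when instantiated: transporters, covariant averagings and the scalar resolvent are DATA / typed operators; no assertion of the dictionary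
B0 that the typed operator is [B9] (3.26) entry-wise, trigger c5); GLOBAL small field, finite torus, linear layer; NOT [B9] (3.23)–(3.26) as
printed (no Dirichlet regions `Ω_j`, no multi-scale kernels); NE2 NOT proved; NOT infinite volume, NOT a mass gap, NOT Clay, NOT summit
progress; spine 0/9 unchanged.  HONEST DEPENDENCY: continuum YM on T⁴ ⇐ BetaPertH ∧ nine spine estimates (0/9 proved); BetaPertH ⇐ (D1) ∧
(D4) ∧ CAP+tail; G-an2-4 gates asym, D1 and NE2/3/4.  ABSOLUTE RULE kept: nothing printed is a hypothesis; no `sorry`.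
-/

noncomputable section

open scoped BigOperators ComplexConjugate Matrix Matrix.Norms.L2Operator

namespace Summit.QuantumFields.BalabanUV.T4Continuum.GaugeTermSandwichLaw

open Summit.QuantumFields.BalabanUV.T4Continuum
open Summit.QuantumFields.BalabanUV.T4Continuum.BackgroundResolventTower

variable {ι : ℕ → Type*} [∀ k, Fintype (ι k)] [∀ k, DecidableEq (ι k)]
variable {υ : Type*} [Fintype υ] [DecidableEq υ]

/-! ## §1 The typed two-level data of one sandwich family -/

/-- **THE SANDWICH DATA** of a family `B_k = Z_kᴴ N_k Z_k` through a fixed unit layer `υ`, relative to free operators `D_k` and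
injections `J_k`: sizes `‖Z_k‖ ≤ z`, `‖N_k‖ ≤ n`, the SANDWICHED two-level consistency of the outer factor
`‖(Z_{k+1}J_k − Z_k)D_k⁻¹‖ ≤ ζ k` and the consistency of the unit-layer factor `‖N_{k+1} − N_k‖ ≤ ν k`.  A hypothesis shape on DATA
(for row B4: `Z_k = Q′(U_k)G′(U_k)D_{U_k}*`, `N_k = (Q′G′²Q′*)⁻¹` at level `k`); NOT IN PRINT; asserted by nobody. [folklore] -/
structure SandwichLaws (D : (k : ℕ) → Matrix (ι k) (ι k) ℂ) (J : (k : ℕ) → Matrix (ι (k + 1)) (ι k) ℂ)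
    (Z : (k : ℕ) → Matrix υ (ι k) ℂ) (N : (k : ℕ) → Matrix υ υ ℂ) (z n : ℝ) (ζ ν : ℕ → ℝ) : Prop where
  /-- `z, n ≥ 0` -/
  nonneg : 0 ≤ z ∧ 0 ≤ n
  /-- size of the outer factor -/
  opNorm_Z_le : ∀ k, ‖Z k‖ ≤ z
  /-- size of the unit-layer factor -/
  opNorm_N_le : ∀ k, ‖N k‖ ≤ n
  /-- sandwiched two-level consistency of the outer factor -/
  consistent_Z_le : ∀ k, ‖(Z (k + 1) * J k - Z k) * (D k)⁻¹‖ ≤ ζ k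
  /-- two-level consistency of the unit-layer factor -/
  consistent_N_le : ∀ k, ‖N (k + 1) - N k‖ ≤ ν k

/-- the sandwich family `B_k = Z_kᴴ N_k Z_k`. [folklore] -/
def sandwich (Z : (k : ℕ) → Matrix υ (ι k) ℂ) (N : (k : ℕ) → Matrix υ υ ℂ) (k : ℕ) : Matrix (ι k) (ι k) ℂ :=
  (Z k)ᴴ * N k * Z k

/-- monotonicity of `SandwichLaws` in the constants. [folklore] -/
theorem sandwichLaws_mono {D : (k : ℕ) → Matrix (ι k) (ι k) ℂ} {J : (k : ℕ) → Matrix (ι (k + 1)) (ι k) ℂ}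
    {Z : (k : ℕ) → Matrix υ (ι k) ℂ} {N : (k : ℕ) → Matrix υ υ ℂ} {z n z' n' : ℝ} {ζ ν ζ' ν' : ℕ → ℝ}
    (h : SandwichLaws D J Z N z n ζ ν) (hz : z ≤ z') (hn : n ≤ n') (hζ : ∀ k, ζ k ≤ ζ' k) (hν : ∀ k, ν k ≤ ν' k) :
    SandwichLaws D J Z N z' n' ζ' ν' where
  nonneg := ⟨h.nonneg.1.trans hz, h.nonneg.2.trans hn⟩
  opNorm_Z_le := fun k => (h.opNorm_Z_le k).trans hz
  opNorm_N_le := fun k => (h.opNorm_N_le k).trans hn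
  consistent_Z_le := fun k => (h.consistent_Z_le k).trans (hζ k)
  consistent_N_le := fun k => (h.consistent_N_le k).trans (hν k)

/-! ## §2 Algebra and the outer defects through the free tower -/

section Algebra

variable {m m' : Type*} [Fintype m] [DecidableEq m] [Fintype m'] [DecidableEq m']

omit [DecidableEq m] [DecidableEq m'] [DecidableEq υ] in
/-- the two-level splitting `Z′ᴴN′Z′J − JZᴴNZ = Z′ᴴN′(Z′J − Z) + Z′ᴴ(N′ − N)Z + (Z′ᴴ − JZᴴ)NZ`. [folklore] -/
theorem sandwich_two_level_split (Z : Matrix υ m ℂ) (Z' : Matrix υ m' ℂ) (N N' : Matrix υ υ ℂ) (J : Matrix m' m ℂ) :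
    Z'ᴴ * N' * Z' * J - J * (Zᴴ * N * Z)
      = Z'ᴴ * N' * (Z' * J - Z) + Z'ᴴ * (N' - N) * Z + (Z'ᴴ - J * Zᴴ) * N * Z := by
  simp only [Matrix.mul_sub, Matrix.sub_mul, Matrix.mul_assoc]
  abel

omit [Fintype m] [DecidableEq m] [DecidableEq υ] in
/-- the difference splitting `Z₁ᴴN₁Z₁ − Z₀ᴴN₀Z₀ = (Z₁ − Z₀)ᴴN₁Z₁ + Z₀ᴴ(N₁ − N₀)Z₁ + Z₀ᴴN₀(Z₁ − Z₀)`. [folklore] -/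
theorem sandwich_sub_split (Z₁ Z₀ : Matrix υ m ℂ) (N₁ N₀ : Matrix υ υ ℂ) :
    Z₁ᴴ * N₁ * Z₁ - Z₀ᴴ * N₀ * Z₀
      = (Z₁ - Z₀)ᴴ * N₁ * Z₁ + Z₀ᴴ * (N₁ - N₀) * Z₁ + Z₀ᴴ * N₀ * (Z₁ - Z₀) := by
  simp only [Matrix.conjTranspose_sub, Matrix.mul_sub, Matrix.sub_mul, Matrix.mul_assoc]
  abel

/-- `‖XᴴYW‖ ≤ ‖X‖‖Y‖‖W‖` (three factors, first adjointed). [folklore] -/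
theorem opNorm_conjTranspose_mul_mul_le {p q : Type*} [Fintype p] [DecidableEq p] [Fintype q] [DecidableEq q]
    (X : Matrix υ m ℂ) (Y : Matrix υ p ℂ) (W : Matrix p q ℂ) : ‖Xᴴ * Y * W‖ ≤ ‖X‖ * ‖Y‖ * ‖W‖ := by
  calc ‖Xᴴ * Y * W‖ ≤ ‖Xᴴ * Y‖ * ‖W‖ := Matrix.l2_opNorm_mul _ _
    _ ≤ ‖Xᴴ‖ * ‖Y‖ * ‖W‖ := mul_le_mul_of_nonneg_right (Matrix.l2_opNorm_mul _ _) (norm_nonneg _)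
    _ = ‖X‖ * ‖Y‖ * ‖W‖ := by rw [Matrix.l2_opNorm_conjTranspose]

/-- **SIZE OF A DIFFERENCE OF SANDWICHES**: `‖Z₁ᴴN₁Z₁ − Z₀ᴴN₀Z₀‖ ≤ δZ·n·z + z·δN·z + z·n·δZ` under common sizes `z, n` and
difference sizes `δZ, δN`. [folklore] -/
theorem opNorm_sandwich_sub_le {Z₁ Z₀ : Matrix υ m ℂ} {N₁ N₀ : Matrix υ υ ℂ} {z n δZ δN : ℝ} (hz : 0 ≤ z) (hn : 0 ≤ n)
    (hZ₁ : ‖Z₁‖ ≤ z) (hZ₀ : ‖Z₀‖ ≤ z) (hN₁ : ‖N₁‖ ≤ n) (hN₀ : ‖N₀‖ ≤ n) (hdZ : ‖Z₁ - Z₀‖ ≤ δZ) (hdN : ‖N₁ - N₀‖ ≤ δN) :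
    ‖Z₁ᴴ * N₁ * Z₁ - Z₀ᴴ * N₀ * Z₀‖ ≤ 2 * z * n * δZ + z * z * δN := by
  have hδZ : 0 ≤ δZ := (norm_nonneg _).trans hdZ
  have hδN : 0 ≤ δN := (norm_nonneg _).trans hdN
  rw [sandwich_sub_split]
  have h1 : ‖(Z₁ - Z₀)ᴴ * N₁ * Z₁‖ ≤ δZ * n * z :=
    (opNorm_conjTranspose_mul_mul_le _ _ _).trans (mul_le_mul (mul_le_mul hdZ hN₁ (norm_nonneg _) hδZ) hZ₁ (norm_nonneg _)
      (mul_nonneg hδZ hn))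
  have h2 : ‖Z₀ᴴ * (N₁ - N₀) * Z₁‖ ≤ z * δN * z :=
    (opNorm_conjTranspose_mul_mul_le _ _ _).trans (mul_le_mul (mul_le_mul hZ₀ hdN (norm_nonneg _) hz) hZ₁ (norm_nonneg _)
      (mul_nonneg hz hδN))
  have h3 : ‖Z₀ᴴ * N₀ * (Z₁ - Z₀)‖ ≤ z * n * δZ :=
    (opNorm_conjTranspose_mul_mul_le _ _ _).trans (mul_le_mul (mul_le_mul hZ₀ hN₀ (norm_nonneg _) hz) hdZ (norm_nonneg _)
      (mul_nonneg hz hn))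
  calc _ ≤ ‖(Z₁ - Z₀)ᴴ * N₁ * Z₁ + Z₀ᴴ * (N₁ - N₀) * Z₁‖ + ‖Z₀ᴴ * N₀ * (Z₁ - Z₀)‖ := norm_add_le _ _
    _ ≤ (‖(Z₁ - Z₀)ᴴ * N₁ * Z₁‖ + ‖Z₀ᴴ * (N₁ - N₀) * Z₁‖) + ‖Z₀ᴴ * N₀ * (Z₁ - Z₀)‖ :=
        add_le_add (norm_add_le _ _) le_rfl
    _ ≤ (δZ * n * z + z * δN * z) + z * n * δZ := add_le_add (add_le_add h1 h2) h3
    _ = 2 * z * n * δZ + z * z * δN := by ring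

/-- **THE LEFT OUTER DEFECT THROUGH THE FREE TOWER.**  For Hermitian free propagators `G = D⁻¹`, `G′ = D′⁻¹` with the injected defect
`‖G′J − JG‖ ≤ e₁`, the complement defect `‖G′(1 − JJᴴ)‖ ≤ e₀`, `‖J‖ ≤ 1`, an outer factor of size `‖Z′‖, ‖Z‖ ≤ z` and sandwiched
consistency `‖(Z′J − Z)G‖ ≤ ζ`:  `‖G′(Z′ᴴ − JZᴴ)‖ ≤ ζ + z(2e₁ + e₀)` — by the identity
`Z′G′ − ZJᴴG′ = (Z′J − Z)GJᴴ + Z′(G′J − JG)Jᴴ + Z′G′(1 − JJᴴ) − Z(G′J − JG)ᴴ`. [folklore] -/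
theorem opNorm_inv_mul_outer_defect_le {G : Matrix m m ℂ} {G' : Matrix m' m' ℂ} {J : Matrix m' m ℂ} {Z : Matrix υ m ℂ}
    {Z' : Matrix υ m' ℂ} {z e₀ e₁ ζ : ℝ} (hGH : Gᴴ = G) (hG'H : G'ᴴ = G') (hJ : ‖J‖ ≤ 1) (hZ : ‖Z‖ ≤ z) (hZ' : ‖Z'‖ ≤ z)
    (hinj : ‖G' * J - J * G‖ ≤ e₁) (hcpl : ‖G' * (1 - J * Jᴴ)‖ ≤ e₀) (hζ : ‖(Z' * J - Z) * G‖ ≤ ζ) :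
    ‖G' * (Z'ᴴ - J * Zᴴ)‖ ≤ ζ + z * (2 * e₁ + e₀) := by
  have hz : 0 ≤ z := (norm_nonneg _).trans hZ
  have he₁ : 0 ≤ e₁ := (norm_nonneg _).trans hinj
  -- pass to the adjoint: `‖G′(Z′ᴴ − JZᴴ)‖ = ‖(Z′ − ZJᴴ)G′‖`
  have hadj : G' * (Z'ᴴ - J * Zᴴ) = ((Z' - Z * Jᴴ) * G')ᴴ := by
    simp only [Matrix.conjTranspose_mul, Matrix.conjTranspose_sub, Matrix.conjTranspose_conjTranspose, hG'H]
  rw [hadj, Matrix.l2_opNorm_conjTranspose]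
  -- the identity
  set E₁ := G' * J - J * G with hE₁
  have hJG' : Jᴴ * G' = G * Jᴴ + E₁ᴴ := by
    have : (G' * J)ᴴ = Jᴴ * G' := by rw [Matrix.conjTranspose_mul, hG'H]
    rw [← this, show G' * J = J * G + E₁ by rw [hE₁]; abel, Matrix.conjTranspose_add, Matrix.conjTranspose_mul, hGH]
  have key : (Z' - Z * Jᴴ) * G'
      = (Z' * J - Z) * G * Jᴴ + Z' * E₁ * Jᴴ + Z' * (G' * (1 - J * Jᴴ)) - Z * E₁ᴴ := by
    have h1 : Z' * G' = Z' * G' * (J * Jᴴ) + Z' * (G' * (1 - J * Jᴴ)) := by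
      rw [Matrix.mul_sub, Matrix.mul_one, Matrix.mul_sub, ← Matrix.mul_assoc Z' G' (J * Jᴴ)]; abel
    have h2 : Z' * G' * (J * Jᴴ) = (Z' * J - Z) * G * Jᴴ + Z * G * Jᴴ + Z' * E₁ * Jᴴ := by
      have : G' * J = J * G + E₁ := by rw [hE₁]; abel
      rw [← Matrix.mul_assoc, Matrix.mul_assoc Z' G' J, this, Matrix.mul_add, Matrix.add_mul, Matrix.sub_mul, Matrix.sub_mul,
        ← Matrix.mul_assoc Z' J G]
      abel
    have h3 : Z * Jᴴ * G' = Z * G * Jᴴ + Z * E₁ᴴ := by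
      rw [Matrix.mul_assoc, hJG', Matrix.mul_add, ← Matrix.mul_assoc]
    rw [Matrix.sub_mul, h1, h2, h3]
    abel
  rw [key]
  have hJH : ‖Jᴴ‖ ≤ 1 := by rw [Matrix.l2_opNorm_conjTranspose]; exact hJ
  have t1 : ‖(Z' * J - Z) * G * Jᴴ‖ ≤ ζ * 1 :=
    (Matrix.l2_opNorm_mul _ _).trans (mul_le_mul hζ hJH (norm_nonneg _) ((norm_nonneg _).trans hζ))
  have t2 : ‖Z' * E₁ * Jᴴ‖ ≤ z * e₁ * 1 :=
    (Matrix.l2_opNorm_mul _ _).trans (mul_le_mul ((Matrix.l2_opNorm_mul _ _).trans (mul_le_mul hZ' hinj (norm_nonneg _) hz))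
      hJH (norm_nonneg _) (mul_nonneg hz he₁))
  have t3 : ‖Z' * (G' * (1 - J * Jᴴ))‖ ≤ z * e₀ :=
    (Matrix.l2_opNorm_mul _ _).trans (mul_le_mul hZ' hcpl (norm_nonneg _) hz)
  have t4 : ‖Z * E₁ᴴ‖ ≤ z * e₁ := by
    refine (Matrix.l2_opNorm_mul _ _).trans ?_
    rw [Matrix.l2_opNorm_conjTranspose]
    exact mul_le_mul hZ hinj (norm_nonneg _) hz
  calc _ ≤ ‖(Z' * J - Z) * G * Jᴴ + Z' * E₁ * Jᴴ + Z' * (G' * (1 - J * Jᴴ))‖ + ‖Z * E₁ᴴ‖ := norm_sub_le _ _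
    _ ≤ (‖(Z' * J - Z) * G * Jᴴ + Z' * E₁ * Jᴴ‖ + ‖Z' * (G' * (1 - J * Jᴴ))‖) + ‖Z * E₁ᴴ‖ :=
        add_le_add (norm_add_le _ _) le_rfl
    _ ≤ ((‖(Z' * J - Z) * G * Jᴴ‖ + ‖Z' * E₁ * Jᴴ‖) + ‖Z' * (G' * (1 - J * Jᴴ))‖) + ‖Z * E₁ᴴ‖ :=
        add_le_add (add_le_add (norm_add_le _ _) le_rfl) le_rfl
    _ ≤ ((ζ * 1 + z * e₁ * 1) + z * e₀) + z * e₁ := add_le_add (add_le_add (add_le_add t1 t2) t3) t4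
    _ = ζ + z * (2 * e₁ + e₀) := by ring

end Algebra

/-! ## §3 (H-cons) for one sandwich family and `PerturbationLaws` for a difference of two -/

section Laws

variable {D : (k : ℕ) → Matrix (ι k) (ι k) ℂ} {A : (k : ℕ) → Matrix (ι k) (ι (k + 1)) ℂ}
  {J : (k : ℕ) → Matrix (ι (k + 1)) (ι k) ℂ} {F : (k : ℕ) → Matrix (ι k) (ι k) ℂ} {r g : ℝ} {e₀ e₁ f : ℕ → ℝ}

/-- the (H-cons) constant of one sandwich family: `g·z·n·(2ζ k + z(2e₁ k + e₀ k)) + g²z²·ν k`. [folklore] -/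
def Esand (g z n : ℝ) (e₀ e₁ ζ ν : ℕ → ℝ) (k : ℕ) : ℝ :=
  g * z * n * (2 * ζ k + z * (2 * e₁ k + e₀ k)) + g * g * z * z * ν k

/-- **(H-cons) FOR ONE SANDWICH FAMILY**: with Hermitian free propagators of size `‖D_k⁻¹‖ ≤ g`, the free tower's injected and
complement defects, and `SandwichLaws D J Z N z n ζ ν`,
`‖D_{k+1}⁻¹·(B_{k+1}J_k − J_kB_k)·D_k⁻¹‖ ≤ Esand g z n e₀ e₁ ζ ν k` for `B_k = Z_kᴴN_kZ_k`. [folklore] -/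
theorem sandwich_consistent_le (hfree : FreeTowerLaws D A J F r e₀ e₁ f) (hG : ∀ k, ‖(D k)⁻¹‖ ≤ g)
    (hGH : ∀ k, ((D k)⁻¹)ᴴ = (D k)⁻¹) {Z : (k : ℕ) → Matrix υ (ι k) ℂ} {N : (k : ℕ) → Matrix υ υ ℂ} {z n : ℝ} {ζ ν : ℕ → ℝ}
    (hS : SandwichLaws D J Z N z n ζ ν) (k : ℕ) :
    ‖(D (k + 1))⁻¹ * (sandwich Z N (k + 1) * J k - J k * sandwich Z N k) * (D k)⁻¹‖ ≤ Esand g z n e₀ e₁ ζ ν k := by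
  obtain ⟨hz, hn⟩ := hS.nonneg
  have hg : 0 ≤ g := (norm_nonneg _).trans (hG k)
  have hζ : 0 ≤ ζ k := (norm_nonneg _).trans (hS.consistent_Z_le k)
  set G := (D k)⁻¹ with hGdef
  set G' := (D (k + 1))⁻¹ with hG'def
  simp only [sandwich]
  rw [sandwich_two_level_split, Matrix.mul_add, Matrix.mul_add, Matrix.add_mul, Matrix.add_mul]
  -- term 1: `G′Z′ᴴN′(Z′J − Z)G`
  have t1 : ‖G' * ((Z (k + 1))ᴴ * N (k + 1) * (Z (k + 1) * J k - Z k)) * G‖ ≤ g * (z * n) * ζ k := by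
    have e : G' * ((Z (k + 1))ᴴ * N (k + 1) * (Z (k + 1) * J k - Z k)) * G
        = G' * ((Z (k + 1))ᴴ * N (k + 1)) * ((Z (k + 1) * J k - Z k) * G) := by simp only [Matrix.mul_assoc]
    rw [e]
    refine (Matrix.l2_opNorm_mul _ _).trans (mul_le_mul ((Matrix.l2_opNorm_mul _ _).trans (mul_le_mul (hG (k + 1))
      ((Matrix.l2_opNorm_mul _ _).trans ?_) (norm_nonneg _) hg)) (hS.consistent_Z_le k) (norm_nonneg _)
      (mul_nonneg hg (mul_nonneg hz hn)))
    rw [Matrix.l2_opNorm_conjTranspose]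
    exact mul_le_mul (hS.opNorm_Z_le _) (hS.opNorm_N_le _) (norm_nonneg _) hz
  -- term 2: `G′Z′ᴴ(N′ − N)ZG`
  have t2 : ‖G' * ((Z (k + 1))ᴴ * (N (k + 1) - N k) * Z k) * G‖ ≤ g * (z * ν k * z) * g := by
    refine (Matrix.l2_opNorm_mul _ _).trans (mul_le_mul ((Matrix.l2_opNorm_mul _ _).trans (mul_le_mul (hG (k + 1))
      ((opNorm_conjTranspose_mul_mul_le _ _ _).trans ?_) (norm_nonneg _) hg)) (hG k) (norm_nonneg _)
      (mul_nonneg hg (mul_nonneg (mul_nonneg hz ((norm_nonneg _).trans (hS.consistent_N_le k))) hz)))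
    exact mul_le_mul (mul_le_mul (hS.opNorm_Z_le _) (hS.consistent_N_le k) (norm_nonneg _) hz) (hS.opNorm_Z_le _)
      (norm_nonneg _) (mul_nonneg hz ((norm_nonneg _).trans (hS.consistent_N_le k)))
  -- term 3: `G′(Z′ᴴ − JZᴴ)NZG`
  have hdef : ‖G' * ((Z (k + 1))ᴴ - J k * (Z k)ᴴ)‖ ≤ ζ k + z * (2 * e₁ k + e₀ k) :=
    opNorm_inv_mul_outer_defect_le (hGH k) (hGH (k + 1)) (hfree.opNorm_J_le k) (hS.opNorm_Z_le k) (hS.opNorm_Z_le (k + 1))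
      (hfree.injected_le k) (hfree.complement_le k) (hS.consistent_Z_le k)
  have t3 : ‖G' * (((Z (k + 1))ᴴ - J k * (Z k)ᴴ) * N k * Z k) * G‖ ≤ (ζ k + z * (2 * e₁ k + e₀ k)) * n * z * g := by
    have e : G' * (((Z (k + 1))ᴴ - J k * (Z k)ᴴ) * N k * Z k) * G = G' * ((Z (k + 1))ᴴ - J k * (Z k)ᴴ) * N k * Z k * G := by
      simp only [Matrix.mul_assoc]
    rw [e]
    have h0 : 0 ≤ ζ k + z * (2 * e₁ k + e₀ k) := (norm_nonneg _).trans hdef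
    refine (Matrix.l2_opNorm_mul _ _).trans (mul_le_mul ((Matrix.l2_opNorm_mul _ _).trans (mul_le_mul
      ((Matrix.l2_opNorm_mul _ _).trans (mul_le_mul hdef (hS.opNorm_N_le k) (norm_nonneg _) h0)) (hS.opNorm_Z_le k)
      (norm_nonneg _) (mul_nonneg h0 hn))) (hG k) (norm_nonneg _) (mul_nonneg (mul_nonneg h0 hn) hz))
  calc _ ≤ ‖G' * ((Z (k + 1))ᴴ * N (k + 1) * (Z (k + 1) * J k - Z k)) * G + G' * ((Z (k + 1))ᴴ * (N (k + 1) - N k) * Z k) * G‖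
          + ‖G' * (((Z (k + 1))ᴴ - J k * (Z k)ᴴ) * N k * Z k) * G‖ := norm_add_le _ _
    _ ≤ (‖G' * ((Z (k + 1))ᴴ * N (k + 1) * (Z (k + 1) * J k - Z k)) * G‖ + ‖G' * ((Z (k + 1))ᴴ * (N (k + 1) - N k) * Z k) * G‖)
          + ‖G' * (((Z (k + 1))ᴴ - J k * (Z k)ᴴ) * N k * Z k) * G‖ := add_le_add (norm_add_le _ _) le_rfl
    _ ≤ (g * (z * n) * ζ k + g * (z * ν k * z) * g) + (ζ k + z * (2 * e₁ k + e₀ k)) * n * z * g := add_le_add (add_le_add t1 t2) t3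
    _ = Esand g z n e₀ e₁ ζ ν k := by simp only [Esand]; ring

/-- **`PerturbationLaws` FOR A DIFFERENCE OF TWO SANDWICH FAMILIES** through the same unit layer and the same free tower: the
relative bound is `g·(2·z·n·δZ + z·z·δN)` from the difference sizes `‖Z¹_k − Z⁰_k‖ ≤ δZ`, `‖N¹_k − N⁰_k‖ ≤ δN` (the size of the
background), the consistency constant is the SUM of the two families' `Esand` (no smallness needed).  For row B4:
`Z¹ = Q′(U)G′(U)D_U*`, `N¹ = (Q′(U)G′(U)²Q′(U)*)⁻¹` and their `U = 1` versions `Z⁰`, `N⁰`. [folklore] -/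
theorem perturbationLaws_sandwich_sub (hfree : FreeTowerLaws D A J F r e₀ e₁ f) (hG : ∀ k, ‖(D k)⁻¹‖ ≤ g)
    (hGH : ∀ k, ((D k)⁻¹)ᴴ = (D k)⁻¹) {Z₁ Z₀ : (k : ℕ) → Matrix υ (ι k) ℂ} {N₁ N₀ : (k : ℕ) → Matrix υ υ ℂ} {z n δZ δN : ℝ}
    {ζ₁ ν₁ ζ₀ ν₀ : ℕ → ℝ} (h₁ : SandwichLaws D J Z₁ N₁ z n ζ₁ ν₁) (h₀ : SandwichLaws D J Z₀ N₀ z n ζ₀ ν₀)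
    (hdZ : ∀ k, ‖Z₁ k - Z₀ k‖ ≤ δZ) (hdN : ∀ k, ‖N₁ k - N₀ k‖ ≤ δN) :
    PerturbationLaws D (fun k => sandwich Z₁ N₁ k - sandwich Z₀ N₀ k) J (g * (2 * z * n * δZ + z * z * δN))
      (fun k => Esand g z n e₀ e₁ ζ₁ ν₁ k + Esand g z n e₀ e₁ ζ₀ ν₀ k) where
  opNorm_P_mul_inv_le := fun k => by
    have hg : 0 ≤ g := (norm_nonneg _).trans (hG k)
    have hB := opNorm_sandwich_sub_le h₁.nonneg.1 h₁.nonneg.2 (h₁.opNorm_Z_le k) (h₀.opNorm_Z_le k) (h₁.opNorm_N_le k)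
      (h₀.opNorm_N_le k) (hdZ k) (hdN k)
    rw [mul_comm g]
    exact (Matrix.l2_opNorm_mul _ _).trans (mul_le_mul hB (hG k) (norm_nonneg _) ((norm_nonneg _).trans hB))
  opNorm_inv_mul_P_le := fun k => by
    have hg : 0 ≤ g := (norm_nonneg _).trans (hG k)
    have hB := opNorm_sandwich_sub_le h₁.nonneg.1 h₁.nonneg.2 (h₁.opNorm_Z_le k) (h₀.opNorm_Z_le k) (h₁.opNorm_N_le k)
      (h₀.opNorm_N_le k) (hdZ k) (hdN k)
    exact (Matrix.l2_opNorm_mul _ _).trans (mul_le_mul (hG k) hB (norm_nonneg _) hg)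
  consistent_le := fun k => by
    have e : (sandwich Z₁ N₁ (k + 1) - sandwich Z₀ N₀ (k + 1)) * J k - J k * (sandwich Z₁ N₁ k - sandwich Z₀ N₀ k)
        = (sandwich Z₁ N₁ (k + 1) * J k - J k * sandwich Z₁ N₁ k) - (sandwich Z₀ N₀ (k + 1) * J k - J k * sandwich Z₀ N₀ k) := by
      rw [Matrix.sub_mul, Matrix.mul_sub]; abel
    rw [e, Matrix.mul_sub, Matrix.sub_mul]
    exact (norm_sub_le _ _).trans (add_le_add (sandwich_consistent_le hfree hG hGH h₁ k) (sandwich_consistent_le hfree hG hGH h₀ k))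

/-- **GEOMETRIC INPUTS GIVE A GEOMETRIC `Esand`**: `e₀ ≤ C₀ρ^k`, `e₁ ≤ C₁ρ^k`, `ζ ≤ Cζρ^k`, `ν ≤ Cνρ^k` (with `g, z, n ≥ 0`) give
`Esand g z n e₀ e₁ ζ ν k ≤ (g·z·n·(2Cζ + z(2C₁ + C₀)) + g²z²Cν)·ρ^k` — the shape `e₂ k ≤ C₂ρ^k` consumed by
`BackgroundResolventTower.towerLimitRate_perturbed` / `NE2PerturbedLayer.towerLimitRate_perturbed_king`. [folklore] -/
theorem Esand_le_geometric {z n : ℝ} (hg : 0 ≤ g) (hz : 0 ≤ z) (hn : 0 ≤ n) {ζ ν : ℕ → ℝ} {ρ C₀ C₁ Cζ Cν : ℝ}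
    (h₀ : ∀ k, e₀ k ≤ C₀ * ρ ^ k) (h₁ : ∀ k, e₁ k ≤ C₁ * ρ ^ k) (hζ : ∀ k, ζ k ≤ Cζ * ρ ^ k) (hν : ∀ k, ν k ≤ Cν * ρ ^ k)
    (k : ℕ) : Esand g z n e₀ e₁ ζ ν k ≤ (g * z * n * (2 * Cζ + z * (2 * C₁ + C₀)) + g * g * z * z * Cν) * ρ ^ k := by
  unfold Esand
  have hgzn : 0 ≤ g * z * n := mul_nonneg (mul_nonneg hg hz) hn
  have ha : 2 * ζ k + z * (2 * e₁ k + e₀ k) ≤ (2 * Cζ + z * (2 * C₁ + C₀)) * ρ ^ k := by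
    have := mul_le_mul_of_nonneg_left (show 2 * e₁ k + e₀ k ≤ (2 * C₁ + C₀) * ρ ^ k by nlinarith [h₀ k, h₁ k]) hz
    nlinarith [hζ k]
  have hb := mul_le_mul_of_nonneg_left ha hgzn
  have hc := mul_le_mul_of_nonneg_left (hν k) (mul_nonneg (mul_nonneg (mul_nonneg hg hg) hz) hz)
  nlinarith [hb, hc]

end Laws

end Summit.QuantumFields.BalabanUV.T4Continuum.GaugeTermSandwichLaw

end
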